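import Mathlib

/-!
# Translation drops the degree by exactly one (below the characteristic)

Solo-informed programme (Langlands / W4 Eisenstein corner), session 26, §7.11 (16.13)(f)(i).  On the functions
`P = Fun(𝔸¹(𝔽_p))` of the affine line of roots of `x^p - η`, the Galois group acts through the affine group; a
translation `x ↦ x + 1` (a Kummer element `b(g) ≠ 0`) sends a polynomial `f` of degree `J`, `0 < J < p`, to
`f(x+1)`, and `f(x+1) - f(x)` has degree EXACTLY `J - 1` with leading coefficient `J · lc(f) ≠ 0`.  This is the
step showing that `P/Fil_k` has no invariants of leading degree `J ≥ k + 2` (hence, with the scaling step,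
`H⁰(G_S, P/Fil_k) = 0` for `k ≤ p - 3`), which makes `H¹(G_S, Fil_k) → H¹(G_S, P)` injective and the ramified
filtration dimensions `dim V_k(η) = h¹(G_S, Fil_k^η)` of the ray census computable.  Stated over `ZMod p`, `p`
prime, for every polynomial of degree `0 < J < p`.
-/

namespace Summit.Langlands.Langlands.Theorems

open Polynomial

section TranslationDrop

variable {p : ℕ} [hp : Fact p.Prime]

/-- The coefficient of `f(X+1)` in degree `natDegree f - 1` is `a_{J-1} + J·a_J` (`J = natDegree f ≥ 1`). -/
theorem soloInformed_coeff_comp_X_add_one_pred (f : (ZMod p)[X]) (hJ : 0 < f.natDegree) :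
    (f.comp (X + 1)).coeff (f.natDegree - 1) =
      f.coeff (f.natDegree - 1) + (f.natDegree : ZMod p) * f.leadingCoeff := by
  have htay : f.comp (X + 1) = taylor 1 f := by
    rw [taylor_apply, map_one]
  rw [htay, taylor_coeff]
  -- `hasseDeriv (J-1) f` has degree ≤ 1; evaluate at 1 as a two-term sum
  have hdeg : (hasseDeriv (f.natDegree - 1) f).natDegree < 2 := by
    have := natDegree_hasseDeriv_le f (f.natDegree - 1)
    omega
  rw [eval_eq_sum_range' hdeg, Finset.sum_range_succ, Finset.sum_range_succ, Finset.sum_range_zero]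
  simp only [one_pow, mul_one, zero_add, hasseDeriv_coeff]
  have h2 : 1 + (f.natDegree - 1) = f.natDegree := by omega
  rw [h2, Nat.choose_self, Nat.cast_one, one_mul]
  have h3 : (f.natDegree).choose (f.natDegree - 1) = f.natDegree := by
    have := Nat.choose_symm (n := f.natDegree) (k := 1) (by omega)
    rw [this, Nat.choose_one_right]
  rw [h3, Polynomial.leadingCoeff]

/-- TRANSLATION DROP: for `0 < natDegree f < p` over `ZMod p`, the difference `f(X+1) - f(X)` is non-zero of
degree exactly `natDegree f - 1`, with the coefficient `J · lc(f)` in that degree. -/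
theorem soloInformed_translation_drop (f : (ZMod p)[X]) (hJ : 0 < f.natDegree) (hJp : f.natDegree < p) :
    (f.comp (X + 1) - f).coeff (f.natDegree - 1) = (f.natDegree : ZMod p) * f.leadingCoeff ∧
    (f.comp (X + 1) - f).coeff (f.natDegree - 1) ≠ 0 ∧
    (f.comp (X + 1) - f).natDegree = f.natDegree - 1 := by
  have hf0 : f ≠ 0 := by
    intro h; rw [h, natDegree_zero] at hJ; exact lt_irrefl 0 hJ
  have hcoeff : (f.comp (X + 1) - f).coeff (f.natDegree - 1) = (f.natDegree : ZMod p) * f.leadingCoeff := by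
    rw [coeff_sub, soloInformed_coeff_comp_X_add_one_pred f hJ]; ring
  have hne : (f.natDegree : ZMod p) * f.leadingCoeff ≠ 0 := by
    refine mul_ne_zero ?_ (leadingCoeff_ne_zero.mpr hf0)
    intro h
    have hdvd : p ∣ f.natDegree := (ZMod.natCast_eq_zero_iff _ _).mp h
    exact absurd (Nat.le_of_dvd hJ hdvd) (not_le.mpr hJp)
  refine ⟨hcoeff, by rwa [hcoeff], ?_⟩
  -- upper bound: same degree and same leading coefficient, so the difference has smaller degree
  have hq : (X + 1 : (ZMod p)[X]).natDegree = 1 := by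
    rw [← C_1, natDegree_X_add_C]
  have hdegc : (f.comp (X + 1)).natDegree = f.natDegree := by
    rw [natDegree_comp, hq, mul_one]
  have hlcc : (f.comp (X + 1)).leadingCoeff = f.leadingCoeff := by
    rw [leadingCoeff_comp (by rw [hq]; exact one_ne_zero), ← C_1, leadingCoeff_X_add_C, one_pow, mul_one]
  have hc0 : f.comp (X + 1) ≠ 0 := by
    intro h
    have := congrArg natDegree h
    rw [hdegc, natDegree_zero] at this
    omega
  have hlt : (f.comp (X + 1) - f).degree < (f.comp (X + 1)).degree :=
    degree_sub_lt (by rw [degree_eq_natDegree hc0, degree_eq_natDegree hf0, hdegc]) hc0 hlcc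
  have hup : (f.comp (X + 1) - f).natDegree < f.natDegree := by
    rw [← hdegc]
    by_cases hz : f.comp (X + 1) - f = 0
    · rw [hz, natDegree_zero, hdegc]; exact hJ
    · exact natDegree_lt_natDegree hz hlt
  have hlow : f.natDegree - 1 ≤ (f.comp (X + 1) - f).natDegree :=
    le_natDegree_of_ne_zero (by rwa [hcoeff])
  omega

/-- Consequence used in (16.13)(f)(i): if `k + 2 ≤ natDegree f < p` then `f(X+1) - f(X)` does NOT have
degree `≤ k` — a class in `P/Fil_k` with leading degree `≥ k + 2` is moved by every non-trivial translation. -/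
theorem soloInformed_translation_not_in_Fil (f : (ZMod p)[X]) (k : ℕ) (hk : k + 2 ≤ f.natDegree)
    (hJp : f.natDegree < p) : k < (f.comp (X + 1) - f).natDegree := by
  have h := (soloInformed_translation_drop f (by omega) hJp).2.2
  omega

end TranslationDrop

end Summit.Langlands.Langlands.Theorems
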